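import Summits.BirchSwinnertonDyer.BirchSwinnertonDyer.Theorems.EdixhovenFibreFiveSevenStarredOptimalManinUnitFiveSevenHcorBlocks
import Literature.NumberTheory.Automorphic.UnboundedDenominatorsInvariantHomTwoPower
import Literature.NumberTheory.ModularForms.ModularGroupAbelianization
import HarnessLib

set_option linter.dupNamespace false

/-!
# K★ crux `StarredOptimalManinUnitFiveSeven`, line `cdt_thm1`: the `2`-adic rounds for `stub_hcor_invariant`

Let `L = m·2^f` with `f ≥ 3`, `m` odd squarefree, `θ : Γ(L) → Q` an `SL₂(ℤ)`-conjugation-invariant homomorphism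
to a finite commutative group and `B ≤ Q` a subgroup containing `θ(T^L)` and all `θ(x)²`.  **Round**
(`map_mem_of_mem_Gamma_four_mul`): `θ(Γ(4L)) ⊆ B`.  Proof: `θ mod B` has image of exponent `2` and kills
`T^L`, so the `2`-adic block certificate `block_certificate_twoPow` (the Schur-multiplier theorem for
`SL₂(ℤ/2^f)`, [Beyl1986]) and the squarefree gluing of `HcorBlocks` give the local condition for `Γ(1)`; an
element `y ∈ Γ(4)` has `y³ ∈ [SL₂(ℤ), SL₂(ℤ)]` (character of `η²`), so `θ(y)³, θ(y)² ∈ B`-classes vanish.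
**Iteration** (`iterate`): `θ(Γ(4^r L)) ⊆ ⟨θ(T^L)^i : 2^r ∣ 2i⟩·Q^{2^r}`; hence an invariant `θ` to a target of
exponent `2^a` kills `Γ(4^{a+1} L)` (`map_eq_one_of_mem_Gamma_pow_mul`).  [CalegariDimitrovTang2025, §4.5].
K★ / Manin / BSD are not proved here.
-/

open scoped MatrixGroups commutatorElement

universe u

namespace Summit.BirchSwinnertonDyer.BirchSwinnertonDyer.Theorems

namespace HcorTwoAdic

open CongruenceSubgroup Matrix.SpecialLinearGroup ModularGroup
open Literature.NumberTheory.Automorphic.UnboundedDenominators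
open Literature.NumberTheory.EllipticCurves.ModularForms (etaSqExp)
open Literature.NumberTheory.ModularForms.SL2Z

/-- For `γ ∈ Γ(4)` the exponent `e(γ)` of the character of `η²` is divisible by `4`. [cite:
Reiner1955RealLinearCharacters, §2] -/
theorem four_dvd_etaSqExp_of_mem_Gamma_four {γ : SL(2, ℤ)} (hγ : γ ∈ Gamma 4) :
    (4 : ℤ) ∣ etaSqExp (γ 0 0) (γ 0 1) (γ 1 0) (γ 1 1) := by
  obtain ⟨h00, h01, h10, h11⟩ := Gamma_mem.mp hγ
  have hz : ((etaSqExp (γ 0 0) (γ 0 1) (γ 1 0) (γ 1 1) : ℤ) : ZMod 4) = 0 := by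
    simp only [etaSqExp]
    push_cast
    rw [h00, h01, h10, h11]
    ring
  exact_mod_cast (ZMod.intCast_zmod_eq_zero_iff_dvd _ 4).mp hz

/-- **`γ ∈ Γ(4) ⟹ γ³ ∈ [SL₂(ℤ), SL₂(ℤ)]`** (the character of `η²` has order dividing `3` on `Γ(4)`). [cite:
Reiner1955RealLinearCharacters, §2] -/
theorem pow_three_mem_commutator_of_mem_Gamma_four {γ : SL(2, ℤ)} (hγ : γ ∈ Gamma 4) :
    γ ^ 3 ∈ commutator SL(2, ℤ) := by
  rw [commutator_eq_ker_etaSqCharacter, MonoidHom.mem_ker, map_pow, etaSqCharacter_apply]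
  obtain ⟨k, hk⟩ := four_dvd_etaSqExp_of_mem_Gamma_four hγ
  rw [hk, ← Complex.exp_nat_mul]
  have : (3 : ℕ) * (Real.pi * Complex.I / 6 * ((4 * k : ℤ) : ℂ)) = k * (2 * Real.pi * Complex.I) := by
    push_cast; ring
  rw [this]
  exact Complex.exp_int_mul_two_pi_mul_I k

/-- **One `2`-adic round.**  `L = m·2^f`, `f ≥ 3`, `m` odd squarefree; `θ : Γ(L) → Q` invariant; `B ≤ Q` contains
`θ(T^L)` and all squares `θ(x)²`.  Then `θ(y) ∈ B` for every `y ∈ Γ(4L)`. [cite: CalegariDimitrovTang2025,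
Corollary 4.5.3] [cite: Beyl1986, Theorem] -/
theorem map_mem_of_mem_Gamma_four_mul {f m : ℕ} (hf : 3 ≤ f) (hm : Squarefree m) (hm2 : m.Coprime 2)
    {Q : Type u} [CommGroup Q] [Finite Q] (θ : Gamma (m * 2 ^ f) →* Q)
    (hθ : ∀ (g x : SL(2, ℤ)) (hx : x ∈ Gamma (m * 2 ^ f)) (hgx : g * x * g⁻¹ ∈ Gamma (m * 2 ^ f)),
      θ ⟨g * x * g⁻¹, hgx⟩ = θ ⟨x, hx⟩)
    (B : Subgroup Q) (hBT : θ ⟨T ^ (m * 2 ^ f), T_pow_mem_Gamma_self _⟩ ∈ B)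
    (hBsq : ∀ x : Gamma (m * 2 ^ f), θ x ^ 2 ∈ B) :
    ∀ (y : SL(2, ℤ)) (hy : y ∈ Gamma (m * 2 ^ f)), y ∈ Gamma (4 * (m * 2 ^ f)) → θ ⟨y, hy⟩ ∈ B := by
  intro y hy hy4
  -- corestrict to the range and divide by `B`
  set R : Subgroup Q := θ.range with hR
  set B₀ : Subgroup R := B.subgroupOf R with hB₀
  haveI : B₀.Normal := inferInstance
  let θ' : Gamma (m * 2 ^ f) →* R ⧸ B₀ := (QuotientGroup.mk' B₀).comp θ.rangeRestrict
  have hθ'val : ∀ x : Gamma (m * 2 ^ f), θ' x = 1 ↔ θ x ∈ B := by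
    intro x
    show (QuotientGroup.mk' B₀) (θ.rangeRestrict x) = 1 ↔ _
    rw [QuotientGroup.mk'_apply, QuotientGroup.eq_one_iff, hB₀, Subgroup.mem_subgroupOf, MonoidHom.coe_rangeRestrict]
  have hθ' : ∀ (g x : SL(2, ℤ)) (hx : x ∈ Gamma (m * 2 ^ f)) (hgx : g * x * g⁻¹ ∈ Gamma (m * 2 ^ f)),
      θ' ⟨g * x * g⁻¹, hgx⟩ = θ' ⟨x, hx⟩ := by
    intro g x hx hgx
    show (QuotientGroup.mk' B₀) (θ.rangeRestrict _) = (QuotientGroup.mk' B₀) (θ.rangeRestrict _)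
    congr 1
    exact Subtype.ext (by rw [MonoidHom.coe_rangeRestrict, MonoidHom.coe_rangeRestrict, hθ g x hx hgx])
  have hQ' : ∀ q : R ⧸ B₀, q ^ 2 = 1 := by
    intro q
    induction q using QuotientGroup.induction_on with
    | H r =>
      obtain ⟨x, hx⟩ := MonoidHom.mem_range.mp r.2
      rw [← QuotientGroup.mk_pow, QuotientGroup.eq_one_iff, hB₀, Subgroup.mem_subgroupOf, Subgroup.coe_pow, ← hx]
      exact hBsq x
  have he' : ∀ x : Gamma (m * 2 ^ f), θ' x ^ (2 ^ 1) = 1 := fun x ↦ by rw [pow_one]; exact hQ' _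
  have hT' : θ' ⟨T ^ (m * 2 ^ f), T_pow_mem_Gamma_self _⟩ = 1 := (hθ'val _).mpr hBT
  -- the `2`-adic block certificate and the squarefree gluing
  have hblock := block_certificate_twoPow hf hm2 (R ⧸ B₀) hQ' θ' hθ' hT'
  have hm0 : m ≠ 0 := Squarefree.ne_zero hm
  have hloc1 := HcorBlocks.local_Gamma_of_squarefree_mul_block (ℓ := 2) (a := 1) Nat.prime_two rfl hm
    (Nat.Coprime.pow_right f hm2) (pow_ne_zero f two_ne_zero) θ' hθ' he' hblock m 1 (mul_one m).symm
  -- `y³ ∈ [SL₂(ℤ), SL₂(ℤ)] ∩ Γ(L)`, so `θ'(y)³ = 1`; with `θ'(y)² = 1` we get `θ'(y) = 1`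
  have hy4' : y ∈ Gamma 4 := Literature.NumberTheory.Automorphic.Wohlfahrt.Gamma_le_Gamma_of_dvd
    (dvd_mul_right 4 _) hy4
  have hy3 : y ^ 3 ∈ ⁅Gamma 1, Gamma 1⁆ ⊔ θ'.ker.map (Gamma (m * 2 ^ f)).subtype := by
    apply Subgroup.mem_sup_left
    rw [CongruenceSubgroup.Gamma_one_top, ← commutator_def]
    exact pow_three_mem_commutator_of_mem_Gamma_four hy4'
  have h3 : θ' ⟨y, hy⟩ ^ 3 = 1 := by
    have h : θ' (⟨y, hy⟩ ^ 3) = 1 := hloc1 (y ^ 3) (pow_mem hy 3) hy3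
    rwa [map_pow] at h
  have h2 : θ' ⟨y, hy⟩ ^ 2 = 1 := hQ' _
  have h1 : θ' ⟨y, hy⟩ = 1 := by
    calc θ' ⟨y, hy⟩ = θ' ⟨y, hy⟩ ^ 3 * (θ' ⟨y, hy⟩ ^ 2)⁻¹ := by group
      _ = 1 := by rw [h3, h2, inv_one, mul_one]
  exact (hθ'val _).mp h1

/-- **Iteration of the rounds.**  For `L = m·2^f` (`f ≥ 3`, `m` odd squarefree), `θ : Γ(L) → Q` invariant and
every `r`: each `θ(y)`, `y ∈ Γ(4^r L)`, is `θ(T^L)^i · q^{2^r}` with `2^r ∣ 2i`. [cite: CalegariDimitrovTang2025,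
Corollary 4.5.3] -/
theorem iterate {f m : ℕ} (hf : 3 ≤ f) (hm : Squarefree m) (hm2 : m.Coprime 2)
    {Q : Type u} [CommGroup Q] [Finite Q] (θ : Gamma (m * 2 ^ f) →* Q)
    (hθ : ∀ (g x : SL(2, ℤ)) (hx : x ∈ Gamma (m * 2 ^ f)) (hgx : g * x * g⁻¹ ∈ Gamma (m * 2 ^ f)),
      θ ⟨g * x * g⁻¹, hgx⟩ = θ ⟨x, hx⟩) (r : ℕ) :
    ∀ (y : SL(2, ℤ)) (hy : y ∈ Gamma (m * 2 ^ f)), y ∈ Gamma (4 ^ r * (m * 2 ^ f)) →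
      ∃ (i : ℕ) (q : Q), 2 ^ r ∣ 2 * i ∧
        θ ⟨y, hy⟩ = θ ⟨T ^ (m * 2 ^ f), T_pow_mem_Gamma_self _⟩ ^ i * q ^ 2 ^ r := by
  induction r with
  | zero =>
    intro y hy _
    exact ⟨0, θ ⟨y, hy⟩, by norm_num, by rw [pow_zero, one_mul, pow_zero, pow_one]⟩
  | succ r ih =>
    intro y hy hyr
    -- the restriction `θ_r` of `θ` to `Γ(L_r)`, `L_r = 4^r L = m · 2^(f + 2r)`
    have hLr : 4 ^ r * (m * 2 ^ f) = m * 2 ^ (f + 2 * r) := by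
      rw [pow_add, pow_mul]; ring
    have hle : Gamma (m * 2 ^ (f + 2 * r)) ≤ Gamma (m * 2 ^ f) :=
      Literature.NumberTheory.Automorphic.Wohlfahrt.Gamma_le_Gamma_of_dvd ⟨4 ^ r, by rw [← hLr]; ring⟩
    let θr : Gamma (m * 2 ^ (f + 2 * r)) →* Q := θ.comp (Subgroup.inclusion hle)
    have hθr_apply : ∀ (x : SL(2, ℤ)) (hx : x ∈ Gamma (m * 2 ^ (f + 2 * r))),
        θr ⟨x, hx⟩ = θ ⟨x, hle hx⟩ := fun x hx ↦ rfl
    have hθr : ∀ (g x : SL(2, ℤ)) (hx : x ∈ Gamma (m * 2 ^ (f + 2 * r)))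
        (hgx : g * x * g⁻¹ ∈ Gamma (m * 2 ^ (f + 2 * r))), θr ⟨g * x * g⁻¹, hgx⟩ = θr ⟨x, hx⟩ := by
      intro g x hx hgx
      rw [hθr_apply, hθr_apply]; exact hθ g x (hle hx) (hle hgx)
    set x₀ : Q := θ ⟨T ^ (m * 2 ^ f), T_pow_mem_Gamma_self _⟩ with hx₀
    -- the subgroup `B = {x₀^i q^(2^(r+1)) : 2^(r+1) ∣ 2 i}`
    let B : Subgroup Q :=
      { carrier := {q | ∃ (i : ℕ) (q' : Q), 2 ^ (r + 1) ∣ 2 * i ∧ q = x₀ ^ i * q' ^ 2 ^ (r + 1)}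
        one_mem' := ⟨0, 1, by norm_num, by rw [pow_zero, one_pow, mul_one]⟩
        mul_mem' := by
          rintro _ _ ⟨i, q, hi, rfl⟩ ⟨i', q', hi', rfl⟩
          refine ⟨i + i', q * q', by rw [mul_add]; exact dvd_add hi hi', ?_⟩
          rw [mul_pow, pow_add x₀ i i']
          simp only [mul_comm, mul_left_comm, mul_assoc]
        inv_mem' := by
          rintro _ ⟨i, q, hi, rfl⟩
          have h1 : (x₀ ^ i) ^ (Nat.card Q - 1) * x₀ ^ i = 1 := by
            rw [← pow_succ, Nat.sub_add_cancel Nat.card_pos]; exact pow_card_eq_one'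
          refine ⟨i * (Nat.card Q - 1), q⁻¹, ?_, ?_⟩
          · rw [← mul_assoc]; exact Dvd.dvd.mul_right hi _
          · rw [mul_inv, inv_pow, pow_mul, inv_eq_of_mul_eq_one_left h1] }
    have hBmem : ∀ q, q ∈ B ↔ ∃ (i : ℕ) (q' : Q), 2 ^ (r + 1) ∣ 2 * i ∧ q = x₀ ^ i * q' ^ 2 ^ (r + 1) :=
      fun q ↦ Iff.rfl
    -- `θ_r(T^{L_r}) = x₀^{4^r} ∈ B`
    have hBT : θr ⟨T ^ (m * 2 ^ (f + 2 * r)), T_pow_mem_Gamma_self _⟩ ∈ B := by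
      rw [hθr_apply]
      have : (⟨T ^ (m * 2 ^ (f + 2 * r)), hle (T_pow_mem_Gamma_self _)⟩ : Gamma (m * 2 ^ f)) =
          ⟨T ^ (m * 2 ^ f), T_pow_mem_Gamma_self _⟩ ^ 4 ^ r := by
        apply Subtype.ext
        rw [Subgroup.coe_pow, Subgroup.coe_mk, Subgroup.coe_mk, ← pow_mul, ← hLr, mul_comm]
      rw [this, map_pow]
      refine (hBmem _).mpr ⟨4 ^ r, 1, ?_, by rw [one_pow, mul_one]⟩
      rw [pow_succ, show (4 : ℕ) ^ r = 2 ^ r * 2 ^ r by rw [← mul_pow]; norm_num]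
      exact ⟨2 ^ r, by ring⟩
    -- squares lie in `B` by the induction hypothesis
    have hBsq : ∀ x : Gamma (m * 2 ^ (f + 2 * r)), θr x ^ 2 ∈ B := by
      rintro ⟨x, hx⟩
      obtain ⟨i, q, hi, hxq⟩ := ih x (hle hx) (by rw [hLr]; exact hx)
      rw [hθr_apply, hxq, mul_pow, ← pow_mul, ← pow_mul, ← pow_succ]
      exact (hBmem _).mpr ⟨i * 2, q, by rw [pow_succ, ← mul_assoc]; exact Nat.mul_dvd_mul hi (dvd_refl 2), rfl⟩
    -- the round
    have h4r : 4 ^ (r + 1) * (m * 2 ^ f) = 4 * (m * 2 ^ (f + 2 * r)) := by rw [← hLr]; ring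
    have hy4 : y ∈ Gamma (4 * (m * 2 ^ (f + 2 * r))) := by rw [← h4r]; exact hyr
    have hy' : y ∈ Gamma (m * 2 ^ (f + 2 * r)) :=
      Literature.NumberTheory.Automorphic.Wohlfahrt.Gamma_le_Gamma_of_dvd (dvd_mul_left _ 4) hy4
    have hmem := map_mem_of_mem_Gamma_four_mul (by omega) hm hm2 θr hθr B hBT hBsq y hy' hy4
    obtain ⟨i, q, hi, hiq⟩ := (hBmem _).mp hmem
    exact ⟨i, q, hi, by rw [← hiq, hθr_apply]⟩

/-- **An invariant `θ : Γ(L) → Q` to a target of exponent `2^a` kills `Γ(4^{a+1} L)`** (`L = m·2^f`, `f ≥ 3`,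
`m` odd squarefree). [cite: CalegariDimitrovTang2025, Corollary 4.5.3] -/
theorem map_eq_one_of_mem_Gamma_pow_mul {f m a : ℕ} (hf : 3 ≤ f) (hm : Squarefree m) (hm2 : m.Coprime 2)
    {Q : Type u} [CommGroup Q] [Finite Q] (hQ : ∀ q : Q, q ^ 2 ^ a = 1) (θ : Gamma (m * 2 ^ f) →* Q)
    (hθ : ∀ (g x : SL(2, ℤ)) (hx : x ∈ Gamma (m * 2 ^ f)) (hgx : g * x * g⁻¹ ∈ Gamma (m * 2 ^ f)),
      θ ⟨g * x * g⁻¹, hgx⟩ = θ ⟨x, hx⟩) :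
    ∀ (y : SL(2, ℤ)) (hy : y ∈ Gamma (m * 2 ^ f)), y ∈ Gamma (4 ^ (a + 1) * (m * 2 ^ f)) → θ ⟨y, hy⟩ = 1 := by
  intro y hy hya
  obtain ⟨i, q, hi, hyq⟩ := iterate hf hm hm2 θ hθ (a + 1) y hy hya
  rw [pow_succ, mul_comm (2 ^ a) 2] at hi
  obtain ⟨j, hj⟩ := (Nat.mul_dvd_mul_iff_left (by norm_num : 0 < 2)).mp hi
  rw [hyq, hj, pow_mul, hQ, one_pow, one_mul, pow_succ, pow_mul, hQ, one_pow]

end HcorTwoAdic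

end Summit.BirchSwinnertonDyer.BirchSwinnertonDyer.Theorems
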